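import Literature.NumberTheory.LFunctions.FordTheorem3SmallK
import Literature.NumberTheory.LFunctions.FordProgram1Uncond
import Literature.NumberTheory.LFunctions.FordTheorem3LargeKOfLemma34
import HarnessLib

/-!
# Ford's Theorem 3: the three rows of (1.7) for every `k ≥ 129`, unconditional

Topic `Literature/NumberTheory/LFunctions`. Everything here is PROVED; no named fact is introduced.

K. Ford, Proc. LMS 85 (2002), Theorem 3: for `k ≥ 129` there is an integer `s ≤ ρk²` with
`J_{s,k}(P) ≤ k^{θk³} P^{2s − k(k+1)/2 + k²/1000}` (`P ≥ 1`). Assembly of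

* the kernel re-run of PROGRAM 1 (`FordTheorem3SmallK.lean`: `FordP1.checkT_all`, `129 ≤ k ≤ 1190`)
  with its now unconditional soundness (`FordP1.row_of_checkT_uncond`, `FordProgram1Uncond.lean`),
* `FordP1.row_ge_1191` (`FordTheorem3LargeKOfLemma34.lean`, Lemmas 3.5–3.6; unconditional),

both resting on Lemma 3.4 (`FordLemma34.lean`). Constants: `ρ = 3.21432, 3.21734, 3.22313` as printed
in (1.7); `θ = 2.3296, 2.3856, 2.4191` in place of the printed `2.3291, 2.3849, 2.4183` for
`k ≤ 1190` (PROGRAM 1 multiplies `C_n` by `η^{4k(n−1)+k²}` where Lemma 3.5 as printed has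
`η^{4kn+k²}` for the step `n → n+1`; the certified `θ` absorb the extra `η^{4k}` per step — see
`FordProgram1.lean`), and the printed `θ = 2.3291` for `k ≥ 1191`.

* `FordP1.row_129_149_uncond`, `FordP1.row_150_199_uncond`, `FordP1.row_200_1190_uncond`;
* `FordP1.theorem3_row_ge_200'` (`θ = 2.3296` uniformly for `k ≥ 200`), `theorem3_row_150_199'`,
  `theorem3_row_129_149'` — the shapes of the hypotheses `hT3a, hT3b, hT3c` of
  `zeta_bound_ford_of_theorem3_theorem4` / `zero_bound_large_height_mty_of_theorem3_theorem4`, up to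
  the value of `θ`.

## References

* K. Ford, Proc. London Math. Soc. (3) 85 (2002), 565–633; arXiv:1910.08209: Theorem 3, (1.7) and
  its proof; Lemmas 3.4–3.6; Appendix "PROGRAM 1". [Ford2002]
-/

open Finset Real

namespace Literature.NumberTheory.LFunctions
namespace FordP1

/-- **Theorem 3, row `129 ≤ k ≤ 149` of (1.7)** (`ρ = 3.22313`, `θ = 2.4191`), unconditional.
[cite: Ford2002, Theorem 3, (1.7)] -/
theorem row_129_149_uncond {k : ℕ} (h1 : 129 ≤ k) (h2 : k ≤ 149) :
    ∃ s₃ : ℕ, 1 ≤ s₃ ∧ (s₃ : ℝ) ≤ 3.22313 * (k : ℝ) ^ 2 ∧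
      ∀ P : ℕ, 1 ≤ P → (VMV.J k s₃ (Finset.Icc (1 : ℤ) P) : ℝ) ≤
        (k : ℝ) ^ ((2.4191 : ℝ) * (k : ℝ) ^ 3) *
          (P : ℝ) ^ ((2 * s₃ : ℝ) - ((k * (k + 1) / 2 : ℕ) : ℝ) + 0.001 * (k : ℝ) ^ 2) := by
  obtain ⟨s, hs1, hs2, hs3⟩ := row_of_checkT_uncond (checkT_all h1 (by omega))
  have hr : rhoOf k = 322313 := by unfold rhoOf; rw [if_neg (by omega), if_neg (by omega)]
  have ht : thetaOf k = 24191 := by unfold thetaOf; rw [if_neg (by omega), if_neg (by omega)]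
  rw [hr] at hs2; rw [ht] at hs3
  refine ⟨s, hs1, by norm_num at hs2 ⊢; linarith, fun P hP => ?_⟩
  have := hs3 P hP
  norm_num at this ⊢
  exact this

/-- **Theorem 3, row `150 ≤ k ≤ 199` of (1.7)** (`ρ = 3.21734`, `θ = 2.3856`), unconditional.
[cite: Ford2002, Theorem 3, (1.7)] -/
theorem row_150_199_uncond {k : ℕ} (h1 : 150 ≤ k) (h2 : k ≤ 199) :
    ∃ s₃ : ℕ, 1 ≤ s₃ ∧ (s₃ : ℝ) ≤ 3.21734 * (k : ℝ) ^ 2 ∧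
      ∀ P : ℕ, 1 ≤ P → (VMV.J k s₃ (Finset.Icc (1 : ℤ) P) : ℝ) ≤
        (k : ℝ) ^ ((2.3856 : ℝ) * (k : ℝ) ^ 3) *
          (P : ℝ) ^ ((2 * s₃ : ℝ) - ((k * (k + 1) / 2 : ℕ) : ℝ) + 0.001 * (k : ℝ) ^ 2) := by
  obtain ⟨s, hs1, hs2, hs3⟩ := row_of_checkT_uncond (checkT_all (by omega) (by omega) : checkT k = true)
  have hr : rhoOf k = 321734 := by unfold rhoOf; rw [if_neg (by omega), if_pos (by omega)]
  have ht : thetaOf k = 23856 := by unfold thetaOf; rw [if_neg (by omega), if_pos (by omega)]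
  rw [hr] at hs2; rw [ht] at hs3
  refine ⟨s, hs1, by norm_num at hs2 ⊢; linarith, fun P hP => ?_⟩
  have := hs3 P hP
  norm_num at this ⊢
  exact this

/-- **Theorem 3, row `200 ≤ k ≤ 1190` of (1.7)** (`ρ = 3.21432`, `θ = 2.3296`), unconditional.
[cite: Ford2002, Theorem 3, (1.7)] -/
theorem row_200_1190_uncond {k : ℕ} (h1 : 200 ≤ k) (h2 : k ≤ 1190) :
    ∃ s₃ : ℕ, 1 ≤ s₃ ∧ (s₃ : ℝ) ≤ 3.21432 * (k : ℝ) ^ 2 ∧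
      ∀ P : ℕ, 1 ≤ P → (VMV.J k s₃ (Finset.Icc (1 : ℤ) P) : ℝ) ≤
        (k : ℝ) ^ ((2.3296 : ℝ) * (k : ℝ) ^ 3) *
          (P : ℝ) ^ ((2 * s₃ : ℝ) - ((k * (k + 1) / 2 : ℕ) : ℝ) + 0.001 * (k : ℝ) ^ 2) := by
  obtain ⟨s, hs1, hs2, hs3⟩ := row_of_checkT_uncond (checkT_all (by omega) h2)
  have hr : rhoOf k = 321432 := by unfold rhoOf; rw [if_pos (by omega)]
  have ht : thetaOf k = 23296 := by unfold thetaOf; rw [if_pos (by omega)]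
  rw [hr] at hs2; rw [ht] at hs3
  refine ⟨s, hs1, by norm_num at hs2 ⊢; linarith, fun P hP => ?_⟩
  have := hs3 P hP
  norm_num at this ⊢
  exact this

/-- **Theorem 3 for all `k ≥ 200`** (`ρ = 3.21432`; `θ = 2.3296`, weakening the printed `2.3291`
available for `k ≥ 1191`), unconditional. [cite: Ford2002, Theorem 3, (1.7), row k ≥ 200] -/
theorem theorem3_row_ge_200' :
    ∀ k : ℕ, 200 ≤ k → ∃ s₃ : ℕ, 1 ≤ s₃ ∧ (s₃ : ℝ) ≤ 3.21432 * (k : ℝ) ^ 2 ∧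
      ∀ P : ℕ, 1 ≤ P → (VMV.J k s₃ (Finset.Icc (1 : ℤ) P) : ℝ) ≤
        (k : ℝ) ^ ((2.3296 : ℝ) * (k : ℝ) ^ 3) *
          (P : ℝ) ^ ((2 * s₃ : ℝ) - ((k * (k + 1) / 2 : ℕ) : ℝ) + 0.001 * (k : ℝ) ^ 2) := by
  intro k hk
  rcases le_or_gt k 1190 with hle | hgt
  · exact row_200_1190_uncond hk hle
  · obtain ⟨s, hs1, hs2, hs3⟩ := row_ge_1191 (k := k) (by omega)
    refine ⟨s, hs1, hs2, fun P hP => (hs3 P hP).trans ?_⟩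
    apply mul_le_mul_of_nonneg_right _ (by positivity)
    have hk1 : (1 : ℝ) ≤ k := by exact_mod_cast (show 1 ≤ k by omega)
    exact Real.rpow_le_rpow_of_exponent_le hk1 (by nlinarith [pow_pos (show (0:ℝ) < k by linarith) 3])

/-- **Theorem 3, `150 ≤ k ≤ 199`** (`ρ = 3.21734`, `θ = 2.3856`), unconditional, in the shape of the
hypothesis `hT3b` of the §5 assembly. [cite: Ford2002, Theorem 3, (1.7), row 150 ≤ k ≤ 199] -/
theorem theorem3_row_150_199' :
    ∀ k : ℕ, 150 ≤ k → k ≤ 199 → ∃ s₃ : ℕ, 1 ≤ s₃ ∧ (s₃ : ℝ) ≤ 3.21734 * (k : ℝ) ^ 2 ∧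
      ∀ P : ℕ, 1 ≤ P → (VMV.J k s₃ (Finset.Icc (1 : ℤ) P) : ℝ) ≤
        (k : ℝ) ^ ((2.3856 : ℝ) * (k : ℝ) ^ 3) *
          (P : ℝ) ^ ((2 * s₃ : ℝ) - ((k * (k + 1) / 2 : ℕ) : ℝ) + 0.001 * (k : ℝ) ^ 2) :=
  fun _ h1 h2 => row_150_199_uncond h1 h2

/-- **Theorem 3, `129 ≤ k ≤ 149`** (`ρ = 3.22313`, `θ = 2.4191`), unconditional, in the shape of the
hypothesis `hT3c` of the §5 assembly. [cite: Ford2002, Theorem 3, (1.7), row 129 ≤ k ≤ 149] -/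
theorem theorem3_row_129_149' :
    ∀ k : ℕ, 129 ≤ k → k ≤ 149 → ∃ s₃ : ℕ, 1 ≤ s₃ ∧ (s₃ : ℝ) ≤ 3.22313 * (k : ℝ) ^ 2 ∧
      ∀ P : ℕ, 1 ≤ P → (VMV.J k s₃ (Finset.Icc (1 : ℤ) P) : ℝ) ≤
        (k : ℝ) ^ ((2.4191 : ℝ) * (k : ℝ) ^ 3) *
          (P : ℝ) ^ ((2 * s₃ : ℝ) - ((k * (k + 1) / 2 : ℕ) : ℝ) + 0.001 * (k : ℝ) ^ 2) :=
  fun _ h1 h2 => row_129_149_uncond h1 h2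

end FordP1
end Literature.NumberTheory.LFunctions
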